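import Summits.Ventures.HodgeRepro2.T5CharacterTheory
import Summits.Ventures.HodgeRepro2.T5CharacterBasics

/-!
# The character determines the multiplicities

Blind cell `pub-hodge-repro2`, seat p1 (gen 12), Tier-5 kernel support for the S4.7 sentence «read off
from characters»: two continuous finite-dimensional representations of a compact group with the same
character contain every irreducible with the same multiplicity, and have the same dimension.

* `finrank_eq_of_character_eq` — equal characters ⇒ equal dimensions (`χ(1) = dim`);
* **`equivCount_eq_of_character_eq`** — equal characters ⇒ for every continuous irreducible `σ` and
  irreducible decompositions `S`, `S'` of the two representations, the numbers of summands equivalent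
  to `σ` agree (both are `∫ χ · conj χ_σ dμ`, `T5CharacterTheory`'s multiplicity formula, no
  unitarity anywhere);
* `exists_decompositions_equivCount_eq` — the existence form.

Honest scope (unchanged): compact groups, finite-dimensional representations; nothing about π₃⁺ or (N).
-/

namespace Summit.Ventures.HodgeRepro2.T5CharacterDetermines

open MeasureTheory T5SchurOrthogonality T5CompleteReducibility T5SchurMathlib T5MultiplicityGeneral

variable {G : Type*} [Group G]
variable {V : Type*} [NormedAddCommGroup V] [InnerProductSpace ℂ V] [FiniteDimensional ℂ V]
variable {V' : Type*} [NormedAddCommGroup V'] [InnerProductSpace ℂ V'] [FiniteDimensional ℂ V']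
variable (π : G →* V →L[ℂ] V) (π' : G →* V' →L[ℂ] V')

/-- Equal characters give equal dimensions. -/
theorem finrank_eq_of_character_eq (h : character π = character π') :
    Module.finrank ℂ V = Module.finrank ℂ V' := by
  have h1 := congrFun h 1
  rw [T5CharacterBasics.character_one, T5CharacterBasics.character_one] at h1
  exact_mod_cast h1

variable [TopologicalSpace G] [IsTopologicalGroup G] [MeasurableSpace G] [BorelSpace G]
  [CompactSpace G]
variable (μ : Measure G) [IsProbabilityMeasure μ] [μ.IsOpenPosMeasure] [μ.IsMulLeftInvariant]

include μ in
/-- **The character determines the multiplicities**: if `χ_π = χ_π'` then, for every continuous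
irreducible `σ`, any irreducible internal-direct-sum decompositions of `V` and `V'` contain the same
number of summands equivalent to `σ`. -/
theorem equivCount_eq_of_character_eq (hπ : Continuous π) (hπ' : Continuous π')
    (h : character π = character π') {W₀ : Type} [NormedAddCommGroup W₀] [InnerProductSpace ℂ W₀]
    [FiniteDimensional ℂ W₀] (σ : G →* W₀ →L[ℂ] W₀) (hσ : Continuous σ)
    [(toRep σ).IsIrreducible]
    (S : Finset (Submodule ℂ V)) (hS : ∀ W ∈ S, IsIrreducibleSubspace π W)
    (hst : ∀ W ∈ S, IsStable π W) (hint : DirectSum.IsInternal (fun W : S => (W : Submodule ℂ V)))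
    (S' : Finset (Submodule ℂ V')) (hS' : ∀ W ∈ S', IsIrreducibleSubspace π' W)
    (hst' : ∀ W ∈ S', IsStable π' W)
    (hint' : DirectSum.IsInternal (fun W : S' => (W : Submodule ℂ V'))) :
    equivCount π σ S hst = equivCount π' σ S' hst' := by
  -- both counts equal the integral of `χ · conj χ_σ` (via the unitarized σ)
  have hc : ∀ g, character (T5Unitarization.unitarizedRep μ σ hσ) g = character σ g := fun g => rfl
  haveI : (toRep (T5Unitarization.unitarizedRep μ σ hσ)).IsIrreducible := ‹(toRep σ).IsIrreducible›
  have e1 := T5Multiplicity.integral_character_mul_conj_eq_card' π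
    (T5Unitarization.unitarizedRep μ σ hσ) μ hπ (T5Unitarization.continuous_unitarizedRep μ σ hσ)
    (T5Unitarization.isUnitary_unitarizedRep μ σ hσ) S hS hst hint
  have e2 := T5Multiplicity.integral_character_mul_conj_eq_card' π'
    (T5Unitarization.unitarizedRep μ σ hσ) μ hπ' (T5Unitarization.continuous_unitarizedRep μ σ hσ)
    (T5Unitarization.isUnitary_unitarizedRep μ σ hσ) S' hS' hst' hint'
  simp only [hc] at e1 e2
  rw [h] at e1
  have hcard : (equivCount π σ S hst : ℂ) = equivCount π' σ S' hst' := by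
    unfold equivCount
    exact e1.symm.trans e2
  exact_mod_cast hcard

include μ in
/-- Existence form: representations with equal characters admit irreducible decompositions with
the same multiplicities for every continuous irreducible `σ`. -/
theorem exists_decompositions_equivCount_eq (hπ : Continuous π) (hπ' : Continuous π')
    (h : character π = character π') :
    ∃ (S : Finset (Submodule ℂ V)) (S' : Finset (Submodule ℂ V')),
      (∀ W ∈ S, IsIrreducibleSubspace π W) ∧ (∀ W ∈ S', IsIrreducibleSubspace π' W) ∧
      ∃ (hst : ∀ W ∈ S, IsStable π W) (hst' : ∀ W ∈ S', IsStable π' W),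
        ∀ {W₀ : Type} [NormedAddCommGroup W₀] [InnerProductSpace ℂ W₀] [FiniteDimensional ℂ W₀]
          (σ : G →* W₀ →L[ℂ] W₀), Continuous σ → ∀ [(toRep σ).IsIrreducible],
          equivCount π σ S hst = equivCount π' σ S' hst' := by
  obtain ⟨S, hS, hint, hst, -⟩ :=
    T5CharacterTheory.exists_decomposition_integral_character_eq_card μ π hπ
  obtain ⟨S', hS', hint', hst', -⟩ :=
    T5CharacterTheory.exists_decomposition_integral_character_eq_card μ π' hπ'
  refine ⟨S, S', hS, hS', hst, hst', ?_⟩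
  intro W₀ _ _ _ σ hσ _
  exact equivCount_eq_of_character_eq π π' μ hπ hπ' h σ hσ S hS hst hint S' hS' hst' hint'

end Summit.Ventures.HodgeRepro2.T5CharacterDetermines
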